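import Mathlib
import Summits.NavierStokesRegularity.NavierStokesRegularity.Theorems.HeteroclinicTriggerChainTriggerChainFrontStepTruncDelayForcedTools
import HarnessLib

/-!
# `HeteroclinicTriggerChain` — crux `TriggerChainFrontStep` (item stmt-NavierStokesRegularity-22785):
  the DELAY PHASE with FORCING (front block of the lattice) — core step of the bootstrap

The delay-phase core step (`…TruncDelaySharp`) re-proved for the FORCED front block
`x′ = −eu² − βuv + f₁`, `u′ = r·u`, `y′ = gu² − e′v² + f₃`, `v′ = β·x_v·u + e′·y_v·v`
with additive forcings `|f₁| ≤ φ₁`, `|f₃| ≤ φ₃`, an abstract trigger rate `|r − (ex − gy)| ≤ φ_r` and perturbed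
coefficient functions `|x_v − x| ≤ ψ_x ≤ 1/4`, `|y_v − y| ≤ ψ_y` in the upper-trigger row, on a window `[0, t]`
with `u ≤ h`; no energy conservation is assumed. Two declarations (one heartbeat budget each):
* `heteroclinicTriggerChain_trunc_delay_bounds_forced` — WEAK `x ≥ 1 − 2δ₁`, `y ≤ (g/e)u² + 2Y₀` ⇒ STRONG
  `1 − δ₁ ≤ x ≤ 1 + φ₁t`, `y(0) − φ₃t ≤ y ≤ y(0) + g(u² − u(0)²)/e + φ₃t`, `0 < u`,
  `0 ≤ v ≤ e^{2Λ}(v(0) + 2β̄u/e) ≤ V` (`β̄ = β(1 + φ₁t + ψ_x)`), and the rate pinch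
  `a ≤ r ≤ b`, `a = e(1−δ₁) − g(Y₀ + gh²/e) − φ_r`, `b = e(1+φ₁t) + gφ₃t + φ_r`;
* `heteroclinicTriggerChain_trunc_delay_core_forced` — adds the exponential law
  `u(0)e^{as} ≤ u ≤ u(0)e^{bs}` and the collected seed with its drift term,
  `v ≥ v(0) + β₋(u − u(0))/e − κs/e`, `β₋ = β(1 − δ₁ − ψ_x)`, `κ = β₋(b − e)h + ee′(φ₃t + ψ_y)V`.
Constants as in the theorem docstrings; with `f₁ = f₃ = 0`, `r = ex − gy`, `x_v = x`, `y_v = y` this is the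
unforced sharp core.
HONEST FRAMING: elementary real-analysis facts about a forced four-dimensional quadratic ODE (MODEL front
block of Tao's lattice, Tao 2016 §4); helper lemmas for the crux, no stub credit; nothing here is a statement
about the Navier–Stokes equations; no summit, rung or crux is proved. NS regularity is not proved by this line.
-/

noncomputable section

-- the sub-problem namespace `Summit.NavierStokesRegularity.NavierStokesRegularity` repeats the summit name by design (D-0017)
set_option linter.dupNamespace false

open Real Set

namespace Summit.NavierStokesRegularity.NavierStokesRegularity.Theorems

/-! ### Strong bounds from weak bounds (forced) -/

/-- **Delay phase with forcing: strong bounds from weak bounds.** Forced front block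
`x′ = −eu² − βuv + f₁`, `u′ = ru`, `y′ = gu² − e′v² + f₃`, `v′ = βx_v u + e′y_v v` (`e > 0`, `g, e′, β ≥ 0`,
`r, y_v` continuous), `x(0) ≤ 1`, `u(0) > 0`, `y(0), v(0) ≥ 0`; on a window `[0, t]`: `u ≤ h`, `|f₁| ≤ φ₁`,
`|f₃| ≤ φ₃`, `|r − (ex − gy)| ≤ φ_r`, `|x_v − x| ≤ ψ_x ≤ 1/4`, `|y_v − y| ≤ ψ_y`, and the WEAK bounds
`x ≥ 1 − 2δ₁`, `y ≤ (g/e)u² + 2Y₀`. Constants: `Y₀ ≥ y(0) + φ₃t`, `2Λ ≥ 2e′(Y₀ + ψ_y)t + e′gh²/e²`,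
`β̄ ≥ β(1 + φ₁t + ψ_x)`, `V ≥ e^{2Λ}(v(0) + 2β̄h/e)`, `δ₁ ≥ 1 − x(0) + h² + 2βVh/e + φ₁t`,
`2δ₁ + (2gY₀ + g²h²/e + φ_r)/e ≤ 1/2`, `4e′e^{4Λ}v(0)² ≤ gu(0)²`, `16e′β̄²e^{4Λ} ≤ ge²`. Then the STRONG
bounds listed in the module docstring hold on `[0, t]`. [folklore] -/
theorem heteroclinicTriggerChain_trunc_delay_bounds_forced (e g e' β : ℝ) (he : 0 < e) (hg : 0 ≤ g)
    (he' : 0 ≤ e') (hβ : 0 ≤ β) (x u y v r xv yv f₁ f₃ : ℝ → ℝ) (hrc : Continuous r)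
    (hyvc : Continuous yv)
    (hx : ∀ s, HasDerivAt x (-(e * u s ^ 2) - β * u s * v s + f₁ s) s)
    (hu : ∀ s, HasDerivAt u (r s * u s) s)
    (hy : ∀ s, HasDerivAt y (g * u s ^ 2 - e' * v s ^ 2 + f₃ s) s)
    (hv : ∀ s, HasDerivAt v (β * xv s * u s + e' * yv s * v s) s)
    (hx0 : x 0 ≤ 1) (hu0 : 0 < u 0) (hy0 : 0 ≤ y 0) (hv0 : 0 ≤ v 0)
    {h Λ δ₁ Y₀ V φ₁ φ₃ φr ψx ψy βb t : ℝ} (hφ₁ : 0 ≤ φ₁) (hφ₃ : 0 ≤ φ₃) (hψy : 0 ≤ ψy)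
    (hψx1 : ψx ≤ 1 / 4) (hβb : β * (1 + φ₁ * t + ψx) ≤ βb)
    (hY₀ : y 0 + φ₃ * t ≤ Y₀)
    (hΛt : 2 * e' * (Y₀ + ψy) * t + e' * g * h ^ 2 / e ^ 2 ≤ 2 * Λ)
    (hV : Real.exp (2 * Λ) * (v 0 + 2 * βb * h / e) ≤ V)
    (hδ₁ : 1 - x 0 + h ^ 2 + 2 * β * V * h / e + φ₁ * t ≤ δ₁)
    (hsmall : 2 * δ₁ + (2 * g * Y₀ + g * (g * h ^ 2 / e) + φr) / e ≤ 1 / 2)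
    (hv0u0 : 4 * e' * Real.exp (4 * Λ) * v 0 ^ 2 ≤ g * u 0 ^ 2)
    (hβe : 16 * e' * βb ^ 2 * Real.exp (4 * Λ) ≤ g * e ^ 2)
    (huh : ∀ s ∈ Icc 0 t, u s ≤ h)
    (hf₁ : ∀ s ∈ Icc 0 t, |f₁ s| ≤ φ₁) (hf₃ : ∀ s ∈ Icc 0 t, |f₃ s| ≤ φ₃)
    (hr : ∀ s ∈ Icc 0 t, |r s - (e * x s - g * y s)| ≤ φr)
    (hxv : ∀ s ∈ Icc 0 t, |xv s - x s| ≤ ψx) (hyv : ∀ s ∈ Icc 0 t, |yv s - y s| ≤ ψy)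
    (hwx : ∀ s ∈ Icc 0 t, 1 - 2 * δ₁ ≤ x s) (hwy : ∀ s ∈ Icc 0 t, y s ≤ g / e * u s ^ 2 + 2 * Y₀) :
    ∀ s ∈ Icc 0 t,
      1 - δ₁ ≤ x s ∧ x s ≤ 1 + φ₁ * t ∧ y 0 - φ₃ * t ≤ y s ∧
      y s ≤ y 0 + g * (u s ^ 2 - u 0 ^ 2) / e + φ₃ * t ∧ 0 < u s ∧ 0 ≤ v s ∧
      v s ≤ Real.exp (2 * Λ) * (v 0 + 2 * βb * u s / e) ∧ v s ≤ V ∧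
      e * (1 - δ₁) - g * (Y₀ + g * h ^ 2 / e) - φr ≤ r s ∧
      r s ≤ e * (1 + φ₁ * t) + g * (φ₃ * t) + φr := by
  intro s₀ hs₀
  have ht : 0 ≤ t := hs₀.1.trans hs₀.2
  have h0mem : (0 : ℝ) ∈ Icc 0 t := left_mem_Icc.2 ht
  have hhpos : 0 < h := lt_of_lt_of_le hu0 (huh 0 h0mem)
  have hupos : ∀ s, 0 < u s := htcTP_pos_of_rate hu hrc hu0
  have hunn : ∀ s, 0 ≤ u s := fun s => (hupos s).le
  -- signs of the constants
  have hφr : 0 ≤ φr := le_trans (abs_nonneg _) (hr 0 h0mem)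
  have hψx : 0 ≤ ψx := le_trans (abs_nonneg _) (hxv 0 h0mem)
  have hY₀nn : 0 ≤ Y₀ := by
    have : 0 ≤ φ₃ * t := by positivity
    linarith
  have h2δ₁ : 2 * δ₁ ≤ 1 / 2 := by
    have : 0 ≤ (2 * g * Y₀ + g * (g * h ^ 2 / e) + φr) / e := by positivity
    linarith
  have hXb : 0 < 1 + φ₁ * t + ψx := by
    have : 0 ≤ φ₁ * t := by positivity
    linarith
  have hβt : 0 ≤ β * (1 + φ₁ * t + ψx) := mul_nonneg hβ hXb.le
  have hβbnn : 0 ≤ βb := hβt.trans hβb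
  have hsmall' : e * (2 * δ₁) + (2 * g * Y₀ + g * (g * h ^ 2 / e) + φr) ≤ e / 2 := by
    have h1 := mul_le_mul_of_nonneg_left hsmall he.le
    have h2 : e * (2 * δ₁ + (2 * g * Y₀ + g * (g * h ^ 2 / e) + φr) / e) =
        e * (2 * δ₁) + (2 * g * Y₀ + g * (g * h ^ 2 / e) + φr) := by
      field_simp
    linarith
  -- (1) weak-phase rate bound and signs of x, x_v
  have hrate : ∀ s ∈ Icc 0 t, e / 2 ≤ r s := by
    intro s hs
    have h1 := (abs_le.1 (hr s hs)).1
    have h2 : e * (1 - 2 * δ₁) ≤ e * x s := mul_le_mul_of_nonneg_left (hwx s hs) he.le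
    have h3 : g * y s ≤ g * (g / e * u s ^ 2 + 2 * Y₀) := mul_le_mul_of_nonneg_left (hwy s hs) hg
    have h4 : u s ^ 2 ≤ h ^ 2 := pow_le_pow_left₀ (hunn s) (huh s hs) 2
    have h5 : g * (g / e * u s ^ 2) ≤ g * (g / e * h ^ 2) :=
      mul_le_mul_of_nonneg_left (mul_le_mul_of_nonneg_left h4 (by positivity)) hg
    have h6 : g * (g / e * h ^ 2) = g * (g * h ^ 2 / e) := by ring
    linarith
  have hxnn : ∀ s ∈ Icc 0 t, 0 ≤ xv s := fun s hs => by
    have h1 := (abs_le.1 (hxv s hs)).1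
    linarith [hwx s hs]
  -- (2) u non-decreasing, v ≥ 0, sharp v bound (with β̄ and the window ceiling of x_v)
  have humono := htcTP_mono_of_rate_nonneg hu hunn (t := t) fun s hs => by linarith [hrate s hs]
  have hvnn : ∀ s ∈ Icc 0 t, 0 ≤ v s :=
    htcTP_upper_nonneg hv hyvc (fun s hs => mul_nonneg (mul_nonneg hβ (hxnn s hs)) (hunn s)) hv0
  -- the carrier ceiling (needs v ≥ 0)
  have hxub : ∀ s ∈ Icc 0 t, x s ≤ x 0 + φ₁ * s :=
    htcTP_carrier_upper_forced he.le hβ hx hunn (fun s hs => (abs_le.1 (hf₁ s hs)).2) hvnn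
  have hxub' : ∀ s ∈ Icc 0 t, x s ≤ 1 + φ₁ * t := fun s hs => by
    have h1 := hxub s hs
    have h2 : φ₁ * s ≤ φ₁ * t := mul_le_mul_of_nonneg_left hs.2 hφ₁
    linarith
  have hv' : ∀ s, HasDerivAt v (βb * (β * xv s / βb) * u s + e' * yv s * v s) s := by
    intro s
    refine (hv s).congr_deriv ?_
    by_cases hb0 : βb = 0
    · have hβ0 : β = 0 := by
        have h1 : β * (1 + φ₁ * t + ψx) ≤ 0 := by rw [← hb0]; exact hβb
        have h2 : β ≤ 0 := by
          by_contra hcon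
          push Not at hcon
          have := mul_pos hcon hXb
          linarith
        linarith
      rw [hb0, hβ0]
      ring
    · field_simp
  have hxv1 : ∀ s ∈ Icc 0 t, β * xv s / βb ≤ 1 := by
    intro s hs
    by_cases hb0 : βb = 0
    · rw [hb0, div_zero]; exact zero_le_one
    · rw [div_le_one (lt_of_le_of_ne hβbnn (Ne.symm hb0))]
      have h1 := (abs_le.1 (hxv s hs)).2
      have h2 : xv s ≤ 1 + φ₁ * t + ψx := by linarith [hxub' s hs]
      exact (mul_le_mul_of_nonneg_left h2 hβ).trans hβb
  have hyv2 : ∀ s ∈ Icc 0 t, yv s ≤ g / e * u s ^ 2 + 2 * (Y₀ + ψy / 2) := by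
    intro s hs
    have h1 := (abs_le.1 (hyv s hs)).2
    linarith [hwy s hs]
  have hY₀' : 0 ≤ Y₀ + ψy / 2 := by positivity
  have hvub0 := htcTP_upper_bound_sharp_on he hβbnn he' hg hY₀' hv' hu hunn hxv1 hrate hvnn hyv2
  have hvub : ∀ s ∈ Icc 0 t, v s ≤ Real.exp (2 * Λ) * (v 0 + 2 * βb * u s / e) := by
    intro s hs
    have h1 := hvub0 s hs
    have h2 : 2 * e' * (Y₀ + ψy / 2) * s + e' * g / e ^ 2 * u s ^ 2 ≤ 2 * Λ := by
      have h4 : 2 * e' * (Y₀ + ψy / 2) * s ≤ 2 * e' * (Y₀ + ψy / 2) * t :=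
        mul_le_mul_of_nonneg_left hs.2 (by positivity)
      have h5 : u s ^ 2 ≤ h ^ 2 := pow_le_pow_left₀ (hunn s) (huh s hs) 2
      have h6 : e' * g / e ^ 2 * u s ^ 2 ≤ e' * g / e ^ 2 * h ^ 2 :=
        mul_le_mul_of_nonneg_left h5 (by positivity)
      have h7 : e' * g / e ^ 2 * h ^ 2 = e' * g * h ^ 2 / e ^ 2 := by ring
      have h8 : 2 * e' * (Y₀ + ψy / 2) * t ≤ 2 * e' * (Y₀ + ψy) * t := by
        have : Y₀ + ψy / 2 ≤ Y₀ + ψy := by linarith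
        have h9 : (0 : ℝ) ≤ 2 * e' := by positivity
        exact mul_le_mul_of_nonneg_right (mul_le_mul_of_nonneg_left this h9) ht
      linarith
    have h3 : 0 ≤ v 0 + 2 * βb * u s / e := by
      have := hunn s
      positivity
    exact h1.trans (mul_le_mul_of_nonneg_right (Real.exp_le_exp.2 h2) h3)
  have hvV : ∀ s ∈ Icc 0 t, v s ≤ V := by
    intro s hs
    refine (hvub s hs).trans (le_trans ?_ hV)
    apply mul_le_mul_of_nonneg_left _ (Real.exp_pos _).le
    have : 2 * βb * u s / e ≤ 2 * βb * h / e :=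
      div_le_div_of_nonneg_right (mul_le_mul_of_nonneg_left (huh s hs) (by positivity)) he.le
    linarith
  have hVnn : 0 ≤ V := (hvnn 0 h0mem).trans (hvV 0 h0mem)
  -- (3) the upper drain is dominated by the pump
  have hdrain : ∀ s ∈ Icc 0 t, e' * v s ^ 2 ≤ g * u s ^ 2 := by
    intro s hs
    have hvs := hvnn s hs
    have hvu := hvub s hs
    have hum := humono s hs
    have hA2 : Real.exp (2 * Λ) ^ 2 = Real.exp (4 * Λ) := by
      rw [sq, ← Real.exp_add]; congr 1; ring
    have h1 : v s ^ 2 ≤ Real.exp (4 * Λ) * (v 0 + 2 * βb * u s / e) ^ 2 := by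
      have := pow_le_pow_left₀ hvs hvu 2
      rw [mul_pow, hA2] at this
      exact this
    have h2 : (v 0 + 2 * βb * u s / e) ^ 2 ≤ 2 * v 0 ^ 2 + 8 * βb ^ 2 * u s ^ 2 / e ^ 2 := by
      have h3 : (v 0 + 2 * βb * u s / e) ^ 2 ≤ 2 * v 0 ^ 2 + 2 * (2 * βb * u s / e) ^ 2 := by
        have h3' : 2 * v 0 ^ 2 + 2 * (2 * βb * u s / e) ^ 2 - (v 0 + 2 * βb * u s / e) ^ 2 =
            (v 0 - 2 * βb * u s / e) ^ 2 := by ring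
        linarith [sq_nonneg (v 0 - 2 * βb * u s / e)]
      have h4 : 2 * (2 * βb * u s / e) ^ 2 = 8 * βb ^ 2 * u s ^ 2 / e ^ 2 := by
        field_simp
        ring
      linarith
    have h5 : e' * v s ^ 2 ≤ e' * Real.exp (4 * Λ) * (2 * v 0 ^ 2) +
        e' * Real.exp (4 * Λ) * (8 * βb ^ 2 * u s ^ 2 / e ^ 2) := by
      have := mul_le_mul_of_nonneg_left (h1.trans (mul_le_mul_of_nonneg_left h2 (Real.exp_pos _).le)) he'
      have h6 : e' * (Real.exp (4 * Λ) * (2 * v 0 ^ 2 + 8 * βb ^ 2 * u s ^ 2 / e ^ 2)) =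
          e' * Real.exp (4 * Λ) * (2 * v 0 ^ 2) + e' * Real.exp (4 * Λ) * (8 * βb ^ 2 * u s ^ 2 / e ^ 2) := by
        ring
      linarith
    have h6 : e' * Real.exp (4 * Λ) * (2 * v 0 ^ 2) ≤ g * u s ^ 2 / 2 := by
      have h7 : u 0 ^ 2 ≤ u s ^ 2 := pow_le_pow_left₀ hu0.le hum 2
      have h8 : g * u 0 ^ 2 ≤ g * u s ^ 2 := mul_le_mul_of_nonneg_left h7 hg
      linarith
    have h7 : e' * Real.exp (4 * Λ) * (8 * βb ^ 2 * u s ^ 2 / e ^ 2) ≤ g * u s ^ 2 / 2 := by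
      have h8 : e' * Real.exp (4 * Λ) * (8 * βb ^ 2 * u s ^ 2 / e ^ 2) =
          (16 * e' * βb ^ 2 * Real.exp (4 * Λ)) * u s ^ 2 / (2 * e ^ 2) := by
        field_simp
        ring
      have h9 : g * u s ^ 2 / 2 = (g * e ^ 2) * u s ^ 2 / (2 * e ^ 2) := by
        field_simp
      rw [h8, h9]
      exact div_le_div_of_nonneg_right (mul_le_mul_of_nonneg_right hβe (sq_nonneg _)) (by positivity)
    linarith
  -- (4) receiver and carrier windows (forced)
  have hyw := htcTP_receiver_window_forced he hg he' hy hu hrate hdrain hf₃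
  have hylb : ∀ s ∈ Icc 0 t, y 0 - φ₃ * t ≤ y s := fun s hs => by
    have h1 := (hyw s hs).1
    have h2 : φ₃ * s ≤ φ₃ * t := mul_le_mul_of_nonneg_left hs.2 hφ₃
    linarith
  have hyub : ∀ s ∈ Icc 0 t, y s ≤ y 0 + g * (u s ^ 2 - u 0 ^ 2) / e + φ₃ * t := fun s hs => by
    have h1 := (hyw s hs).2
    have h2 : φ₃ * s ≤ φ₃ * t := mul_le_mul_of_nonneg_left hs.2 hφ₃
    linarith
  have hyub' : ∀ s ∈ Icc 0 t, y s ≤ Y₀ + g * h ^ 2 / e := fun s hs => by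
    have h1 := hyub s hs
    have h2 : u s ^ 2 ≤ h ^ 2 := pow_le_pow_left₀ (hunn s) (huh s hs) 2
    have h3 : g * (u s ^ 2 - u 0 ^ 2) / e ≤ g * h ^ 2 / e := by
      apply div_le_div_of_nonneg_right _ he.le
      apply mul_le_mul_of_nonneg_left _ hg
      linarith [sq_nonneg (u 0)]
    linarith
  have hxw := htcTP_carrier_window_forced he hβ hVnn hx hu hunn hrate hvV
    (fun s hs => (abs_le.1 (hf₁ s hs)).1)
  have hxlb : ∀ s ∈ Icc 0 t, 1 - δ₁ ≤ x s := by
    intro s hs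
    have h1 := hxw s hs
    have h2 : u s ^ 2 ≤ h ^ 2 := pow_le_pow_left₀ (hunn s) (huh s hs) 2
    have h3 : u s ^ 2 - u 0 ^ 2 ≤ h ^ 2 := by linarith [sq_nonneg (u 0)]
    have h4 : 2 * β * V * (u s - u 0) / e ≤ 2 * β * V * h / e := by
      apply div_le_div_of_nonneg_right _ he.le
      have : u s - u 0 ≤ h := by linarith [huh s hs, hu0]
      exact mul_le_mul_of_nonneg_left this (by positivity)
    have h5 : φ₁ * s ≤ φ₁ * t := mul_le_mul_of_nonneg_left hs.2 hφ₁
    linarith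
  -- (5) strong rate bounds and the exponential law
  have hrate2 : ∀ s ∈ Icc 0 t, e * (1 - δ₁) - g * (Y₀ + g * h ^ 2 / e) - φr ≤ r s := by
    intro s hs
    have h1 := (abs_le.1 (hr s hs)).1
    have h2 : e * (1 - δ₁) ≤ e * x s := mul_le_mul_of_nonneg_left (hxlb s hs) he.le
    have h3 : g * y s ≤ g * (Y₀ + g * h ^ 2 / e) := mul_le_mul_of_nonneg_left (hyub' s hs) hg
    linarith
  have hrate3 : ∀ s ∈ Icc 0 t, r s ≤ e * (1 + φ₁ * t) + g * (φ₃ * t) + φr := by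
    intro s hs
    have h1 := (abs_le.1 (hr s hs)).2
    have h2 : e * x s ≤ e * (1 + φ₁ * t) := mul_le_mul_of_nonneg_left (hxub' s hs) he.le
    have h3 : g * (y 0 - φ₃ * t) ≤ g * y s := mul_le_mul_of_nonneg_left (hylb s hs) hg
    have h4 : 0 ≤ g * y 0 := mul_nonneg hg hy0
    have h5 : g * (y 0 - φ₃ * t) = g * y 0 - g * (φ₃ * t) := by ring
    linarith
  exact ⟨hxlb s₀ hs₀, hxub' s₀ hs₀, hylb s₀ hs₀, hyub s₀ hs₀, hupos s₀, hvnn s₀ hs₀, hvub s₀ hs₀,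
    hvV s₀ hs₀, hrate2 s₀ hs₀, hrate3 s₀ hs₀⟩

/-! ### The core step with forcing -/

/-- **Delay phase with forcing, core step of the bootstrap.** Forced front block
`x′ = −eu² − βuv + f₁`, `u′ = ru`, `y′ = gu² − e′v² + f₃`, `v′ = βx_v u + e′y_v v` (`e > 0`, `g, e′, β ≥ 0`,
`r, y_v` continuous), `x(0) ≤ 1`, `u(0) > 0`, `y(0), v(0) ≥ 0`; on a window `[0, t]`: `u ≤ h`, `|f₁| ≤ φ₁`,
`|f₃| ≤ φ₃`, `|r − (ex − gy)| ≤ φ_r`, `|x_v − x| ≤ ψ_x ≤ 1/4`, `|y_v − y| ≤ ψ_y`, and the WEAK bounds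
`x ≥ 1 − 2δ₁`, `y ≤ (g/e)u² + 2Y₀`. Constants: `Y₀ ≥ y(0) + φ₃t`, `2Λ ≥ 2e′(Y₀ + ψ_y)t + e′gh²/e²`,
`β̄ ≥ β(1 + φ₁t + ψ_x)`, `V ≥ e^{2Λ}(v(0) + 2β̄h/e)`, `δ₁ ≥ 1 − x(0) + h² + 2βVh/e + φ₁t`,
`2δ₁ + (2gY₀ + g²h²/e + φ_r)/e ≤ 1/2`, `4e′e^{4Λ}v(0)² ≤ gu(0)²`, `16e′β̄²e^{4Λ} ≤ ge²`. Then the STRONG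
bounds listed in the module docstring hold on `[0, t]`. [folklore] -/
theorem heteroclinicTriggerChain_trunc_delay_core_forced (e g e' β : ℝ) (he : 0 < e) (hg : 0 ≤ g)
    (he' : 0 ≤ e') (hβ : 0 ≤ β) (x u y v r xv yv f₁ f₃ : ℝ → ℝ) (hrc : Continuous r)
    (hyvc : Continuous yv)
    (hx : ∀ s, HasDerivAt x (-(e * u s ^ 2) - β * u s * v s + f₁ s) s)
    (hu : ∀ s, HasDerivAt u (r s * u s) s)
    (hy : ∀ s, HasDerivAt y (g * u s ^ 2 - e' * v s ^ 2 + f₃ s) s)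
    (hv : ∀ s, HasDerivAt v (β * xv s * u s + e' * yv s * v s) s)
    (hx0 : x 0 ≤ 1) (hu0 : 0 < u 0) (hy0 : 0 ≤ y 0) (hv0 : 0 ≤ v 0)
    {h Λ δ₁ Y₀ V φ₁ φ₃ φr ψx ψy βb t : ℝ} (hφ₁ : 0 ≤ φ₁) (hφ₃ : 0 ≤ φ₃) (hψy : 0 ≤ ψy)
    (hψx1 : ψx ≤ 1 / 4) (hβb : β * (1 + φ₁ * t + ψx) ≤ βb)
    (hY₀ : y 0 + φ₃ * t ≤ Y₀)
    (hΛt : 2 * e' * (Y₀ + ψy) * t + e' * g * h ^ 2 / e ^ 2 ≤ 2 * Λ)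
    (hV : Real.exp (2 * Λ) * (v 0 + 2 * βb * h / e) ≤ V)
    (hδ₁ : 1 - x 0 + h ^ 2 + 2 * β * V * h / e + φ₁ * t ≤ δ₁)
    (hsmall : 2 * δ₁ + (2 * g * Y₀ + g * (g * h ^ 2 / e) + φr) / e ≤ 1 / 2)
    (hv0u0 : 4 * e' * Real.exp (4 * Λ) * v 0 ^ 2 ≤ g * u 0 ^ 2)
    (hβe : 16 * e' * βb ^ 2 * Real.exp (4 * Λ) ≤ g * e ^ 2)
    (huh : ∀ s ∈ Icc 0 t, u s ≤ h)
    (hf₁ : ∀ s ∈ Icc 0 t, |f₁ s| ≤ φ₁) (hf₃ : ∀ s ∈ Icc 0 t, |f₃ s| ≤ φ₃)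
    (hr : ∀ s ∈ Icc 0 t, |r s - (e * x s - g * y s)| ≤ φr)
    (hxv : ∀ s ∈ Icc 0 t, |xv s - x s| ≤ ψx) (hyv : ∀ s ∈ Icc 0 t, |yv s - y s| ≤ ψy)
    (hwx : ∀ s ∈ Icc 0 t, 1 - 2 * δ₁ ≤ x s) (hwy : ∀ s ∈ Icc 0 t, y s ≤ g / e * u s ^ 2 + 2 * Y₀) :
    ∀ s ∈ Icc 0 t,
      1 - δ₁ ≤ x s ∧ x s ≤ 1 + φ₁ * t ∧ y 0 - φ₃ * t ≤ y s ∧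
      y s ≤ y 0 + g * (u s ^ 2 - u 0 ^ 2) / e + φ₃ * t ∧ 0 < u s ∧ 0 ≤ v s ∧
      v s ≤ Real.exp (2 * Λ) * (v 0 + 2 * βb * u s / e) ∧
      u 0 * Real.exp ((e * (1 - δ₁) - g * (Y₀ + g * h ^ 2 / e) - φr) * s) ≤ u s ∧
      u s ≤ u 0 * Real.exp ((e * (1 + φ₁ * t) + g * (φ₃ * t) + φr) * s) ∧
      v 0 + β * (1 - δ₁ - ψx) * (u s - u 0) / e -
        (β * (1 - δ₁ - ψx) * ((e * (1 + φ₁ * t) + g * (φ₃ * t) + φr) - e) * h +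
          e * e' * (φ₃ * t + ψy) * V) * s / e ≤ v s := by
  intro s₀ hs₀
  have ht : 0 ≤ t := hs₀.1.trans hs₀.2
  have h0mem : (0 : ℝ) ∈ Icc 0 t := left_mem_Icc.2 ht
  have hA := heteroclinicTriggerChain_trunc_delay_bounds_forced e g e' β he hg he' hβ x u y v r xv yv f₁ f₃
    hrc hyvc hx hu hy hv hx0 hu0 hy0 hv0 hφ₁ hφ₃ hψy hψx1 hβb hY₀ hΛt hV hδ₁ hsmall hv0u0 hβe huh hf₁ hf₃
    hr hxv hyv hwx hwy
  have hupos : ∀ s, 0 < u s := htcTP_pos_of_rate hu hrc hu0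
  have hunn : ∀ s, 0 ≤ u s := fun s => (hupos s).le
  have hφr : 0 ≤ φr := le_trans (abs_nonneg _) (hr 0 h0mem)
  have hVnn : 0 ≤ V := (hA 0 h0mem).2.2.2.2.2.1.trans (hA 0 h0mem).2.2.2.2.2.2.2.1
  -- exponential law
  have hulb := htcTP_exp_growth_lower hu hunn (t := t) fun s hs => (hA s hs).2.2.2.2.2.2.2.2.1
  have huub := htcTP_exp_growth_upper hu hunn (t := t) fun s hs => (hA s hs).2.2.2.2.2.2.2.2.2
  -- the collected seed with its drift term
  set b : ℝ := e * (1 + φ₁ * t) + g * (φ₃ * t) + φr with hb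
  have hbe : e ≤ b := by
    have : 0 ≤ e * (φ₁ * t) + g * (φ₃ * t) + φr := by positivity
    rw [hb]; linarith
  have h2δ₁ : 2 * δ₁ ≤ 1 / 2 := by
    have hY₀nn : 0 ≤ Y₀ := by
      have : 0 ≤ φ₃ * t := by positivity
      linarith
    have : 0 ≤ (2 * g * Y₀ + g * (g * h ^ 2 / e) + φr) / e := by positivity
    linarith
  set βm : ℝ := β * (1 - δ₁ - ψx) with hβm
  have hβmnn : 0 ≤ βm := by
    rw [hβm]
    have : 0 ≤ 1 - δ₁ - ψx := by linarith
    positivity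
  set κ : ℝ := βm * (b - e) * h + e * e' * (φ₃ * t + ψy) * V with hκ
  have hR : ∀ s, HasDerivAt (fun q => e * v q - βm * u q + κ * q)
      (e * (β * xv s * u s + e' * yv s * v s) - βm * (r s * u s) + κ * 1) s :=
    fun s => (((hv s).const_mul e).sub ((hu s).const_mul βm)).add ((hasDerivAt_id' s).const_mul κ)
  have hR' : ∀ s ∈ Icc 0 t, 0 ≤ e * (β * xv s * u s + e' * yv s * v s) - βm * (r s * u s) + κ * 1 := by
    intro s hs
    obtain ⟨hxlb, -, hylb, -, -, hvs, -, hvVs, -, hr3⟩ := hA s hs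
    have hus := hunn s
    -- β x_v u ≥ βm u
    have h1 : βm * u s ≤ β * xv s * u s := by
      have h2 : 1 - δ₁ - ψx ≤ xv s := by
        have := (abs_le.1 (hxv s hs)).1
        linarith
      have h3 := mul_le_mul_of_nonneg_left h2 hβ
      rw [hβm]
      exact mul_le_mul_of_nonneg_right h3 hus
    have h1e := mul_le_mul_of_nonneg_left h1 he.le
    -- e′ y_v v ≥ −e′(φ₃ t + ψ_y) V
    have h4 : -(e' * ((φ₃ * t + ψy) * V)) ≤ e' * (yv s * v s) := by
      have h5 : -(φ₃ * t + ψy) ≤ yv s := by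
        have := (abs_le.1 (hyv s hs)).1
        linarith
      have h6 : -(φ₃ * t + ψy) * v s ≤ yv s * v s := mul_le_mul_of_nonneg_right h5 hvs
      have h7 : (φ₃ * t + ψy) * v s ≤ (φ₃ * t + ψy) * V :=
        mul_le_mul_of_nonneg_left hvVs (by positivity)
      have h8 := mul_le_mul_of_nonneg_left h6 he'
      have h9 := mul_le_mul_of_nonneg_left h7 he'
      have h10 : e' * (-(φ₃ * t + ψy) * v s) = -(e' * ((φ₃ * t + ψy) * v s)) := by ring
      linarith
    have h4e := mul_le_mul_of_nonneg_left h4 he.le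
    -- βm r u ≤ βm b u = βm e u + βm (b − e) u ≤ βm e u + βm (b − e) h
    have h9 : βm * (r s * u s) ≤ βm * (b * u s) :=
      mul_le_mul_of_nonneg_left (mul_le_mul_of_nonneg_right hr3 hus) hβmnn
    have h10 : βm * ((b - e) * u s) ≤ βm * ((b - e) * h) :=
      mul_le_mul_of_nonneg_left (mul_le_mul_of_nonneg_left (huh s hs) (by linarith)) hβmnn
    have h11 : βm * (b * u s) = e * (βm * u s) + βm * ((b - e) * u s) := by ring
    have h12 : e * (β * xv s * u s + e' * yv s * v s) =
        e * (β * xv s * u s) + e * (e' * (yv s * v s)) := by ring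
    have h13 : e * -(e' * ((φ₃ * t + ψy) * V)) = -(e * e' * (φ₃ * t + ψy) * V) := by ring
    rw [h12, hκ]
    linarith
  have hRle := htcTP_le_of_deriv_nonneg hR hR'
  have hseed : v 0 + βm * (u s₀ - u 0) / e - κ * s₀ / e ≤ v s₀ := by
    have h1 := hRle s₀ hs₀
    simp only [mul_zero, add_zero] at h1
    have h2 : v 0 + βm * (u s₀ - u 0) / e - κ * s₀ / e = (e * v 0 + βm * (u s₀ - u 0) - κ * s₀) / e := by
      field_simp
    rw [h2, div_le_iff₀ he]
    linarith
  obtain ⟨c1, c2, c3, c4, c5, c6, c7, -, -, -⟩ := hA s₀ hs₀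
  refine ⟨c1, c2, c3, c4, c5, c6, c7, hulb s₀ hs₀, huub s₀ hs₀, ?_⟩
  simpa only [hβm, hκ, hb] using hseed

end Summit.NavierStokesRegularity.NavierStokesRegularity.Theorems

end
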